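import Mathlib
import Summits.Ventures.HodgeRepro.Tier4.Target
import Summits.Ventures.HodgeRepro.Tier4.Common.TargetBall

/-!
# Tier4/Common/FixedSetNull — the fixed set in the ball of a non-scalar element of `U(2,1)` is Lebesgue-null

Blind re-derivation cell `pub-hodge-repro`, Tier 4 «prove the step» (README §9–§10), seat t4-L4-p1 (prover, LINE L4,
gen 0; lead's assignment S12161 (3), shared module announced S12255).  Tree path
`lean/Summits/Ventures/HodgeRepro/Tier4/Common/FixedSetNull.lean`.  Mathlib-level; no literature input.

WHAT IS PROVED.  `volume_fixed_null`: for `N ∈ U(2,1)` that is not a scalar matrix, `{x ∈ 𝔹² | actM N x = x}` has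
Lebesgue measure `0`.  A fixed point `x` gives an eigenvector `(x, 1)` of `N` (`N (x,1) = c (x,1)`, `c = (N (x,1))₂ ≠ 0`
on the ball), so `c` is a root of the characteristic polynomial (`Matrix.eval_charpoly`, `Matrix.exists_mulVec_eq_zero_iff`)
— finitely many values — and `{x | (c·1 − N)(x, 1) = 0}` is, for `c·1 − N ≠ 0`, a translate of a proper `ℝ`-subspace
of `ℂ²` (`solutionSet_eq`, `eq_zero_of_ker_eq_top`), hence null (`Measure.addHaar_submodule`, `measure_vadd`).
Also `actM_smul`: `actM (c • M) = actM M` for `c ≠ 0` (the action only sees `M` up to scalars).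

Consumed by `Tier4/Common/FundamentalDomain.lean` (almost-disjointness of the translates of the transversal).
HC_CM is NOT proved by anyone in this repository.
-/

set_option autoImplicit false

noncomputable section

open Matrix Metric NumberField MeasureTheory
open scoped ComplexConjugate ComplexOrder Pointwise

namespace Summit.Ventures.HodgeRepro.Tier4

/-! ## E. The fixed set of a non-scalar element of `U(2,1)` is Lebesgue-null -/

section FixedSet

/-- `(z, 1) ≠ 0`. -/
theorem lift3_ne_zero (x : Fin 2 → ℂ) : lift3 x ≠ 0 := by
  intro h
  have := congrFun h 2
  simp [lift3] at this

/-- The `ℝ`-linear embedding `ℂ² → ℂ³`, `x ↦ (x₀, x₁, 0)`. -/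
def ιlin : (Fin 2 → ℂ) →ₗ[ℝ] (Fin 3 → ℂ) where
  toFun x := ![x 0, x 1, 0]
  map_add' x y := by ext i; fin_cases i <;> simp
  map_smul' c x := by ext i; fin_cases i <;> simp

/-- `(x, 1) = ι x + e₂`. -/
theorem lift3_eq (x : Fin 2 → ℂ) : lift3 x = ιlin x + ![0, 0, 1] := by
  ext i
  fin_cases i <;> simp [lift3, ιlin]

/-- The `ℝ`-linear map `x ↦ L (ι x)`. -/
def linL (L : Matrix (Fin 3) (Fin 3) ℂ) : (Fin 2 → ℂ) →ₗ[ℝ] (Fin 3 → ℂ) :=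
  ((Matrix.toLin' L).restrictScalars ℝ).comp ιlin

/-- `linL L x = L (ι x)`. -/
theorem linL_apply (L : Matrix (Fin 3) (Fin 3) ℂ) (x : Fin 2 → ℂ) : linL L x = L *ᵥ ιlin x := by
  simp [linL]

/-- The solution set of `L (x, 1) = 0` is a translate of the kernel of `linL L` (when non-empty). -/
theorem solutionSet_eq (L : Matrix (Fin 3) (Fin 3) ℂ) {x₀ : Fin 2 → ℂ} (hx₀ : L *ᵥ lift3 x₀ = 0) :
    {x : Fin 2 → ℂ | L *ᵥ lift3 x = 0} = x₀ +ᵥ (LinearMap.ker (linL L) : Set (Fin 2 → ℂ)) := by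
  ext x
  rw [Set.mem_vadd_set_iff_neg_vadd_mem, SetLike.mem_coe, LinearMap.mem_ker, vadd_eq_add, linL_apply]
  simp only [Set.mem_setOf_eq]
  have h : L *ᵥ ιlin (-x₀ + x) = L *ᵥ lift3 x - L *ᵥ lift3 x₀ := by
    rw [map_add, map_neg, Matrix.mulVec_add, Matrix.mulVec_neg, lift3_eq x, lift3_eq x₀, Matrix.mulVec_add,
      Matrix.mulVec_add]
    abel
  rw [h, hx₀, sub_zero]

/-- If `L (x₀, 1) = 0` and `L ∘ ι = 0`, then `L = 0`. -/
theorem eq_zero_of_ker_eq_top (L : Matrix (Fin 3) (Fin 3) ℂ) {x₀ : Fin 2 → ℂ} (hx₀ : L *ᵥ lift3 x₀ = 0)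
    (hker : LinearMap.ker (linL L) = ⊤) : L = 0 := by
  have hι : ∀ x, L *ᵥ ιlin x = 0 := fun x => by
    have : x ∈ LinearMap.ker (linL L) := by rw [hker]; trivial
    rwa [LinearMap.mem_ker, linL_apply] at this
  have he : L *ᵥ ![0, 0, 1] = 0 := by
    have := hx₀
    rwa [lift3_eq, Matrix.mulVec_add, hι, zero_add] at this
  have hcol : ∀ j : Fin 3, L *ᵥ Pi.single j 1 = 0 := by
    intro j
    fin_cases j
    · have := hι (Pi.single 0 1)
      convert this using 2
      ext k; fin_cases k <;> simp [ιlin]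
    · have := hι (Pi.single 1 1)
      convert this using 2
      ext k; fin_cases k <;> simp [ιlin]
    · convert he using 2
      ext k; fin_cases k <;> simp
  ext i j
  have := congrFun (hcol j) i
  rw [Matrix.mulVec_single_one] at this
  simpa using this

/-- **The solution set of `L (x, 1) = 0` is Lebesgue-null for `L ≠ 0`.** -/
theorem volume_solutionSet (L : Matrix (Fin 3) (Fin 3) ℂ) (hL : L ≠ 0) :
    volume {x : Fin 2 → ℂ | L *ᵥ lift3 x = 0} = 0 := by
  by_cases hne : ∃ x₀, L *ᵥ lift3 x₀ = 0
  · obtain ⟨x₀, hx₀⟩ := hne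
    rw [solutionSet_eq L hx₀, measure_vadd]
    refine Measure.addHaar_submodule volume _ fun htop => hL ?_
    exact eq_zero_of_ker_eq_top L hx₀ htop
  · have : {x : Fin 2 → ℂ | L *ᵥ lift3 x = 0} = ∅ := by
      rw [Set.eq_empty_iff_forall_notMem]
      intro x hx
      exact hne ⟨x, hx⟩
    rw [this, measure_empty]

/-- `scalar c *ᵥ v = c • v`. -/
theorem scalar_mulVec (c : ℂ) (v : Fin 3 → ℂ) : Matrix.scalar (Fin 3) c *ᵥ v = c • v := by
  ext i
  simp [Matrix.scalar_apply, Matrix.mulVec_diagonal]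

/-- **The fixed set in the ball of a non-scalar `N ∈ U(2,1)` is Lebesgue-null.** -/
theorem volume_fixed_null {N : Matrix (Fin 3) (Fin 3) ℂ} (hN : Nᴴ * J * N = J)
    (hns : ∀ c : ℂ, N ≠ Matrix.scalar (Fin 3) c) :
    volume {x : Fin 2 → ℂ | x ∈ ball ∧ actM N x = x} = 0 := by
  have hp : N.charpoly ≠ 0 := (Matrix.charpoly_monic N).ne_zero
  have hsub : {x : Fin 2 → ℂ | x ∈ ball ∧ actM N x = x} ⊆
      ⋃ c ∈ (N.charpoly.roots.toFinset : Set ℂ), {x : Fin 2 → ℂ | (Matrix.scalar (Fin 3) c - N) *ᵥ lift3 x = 0} := by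
    rintro x ⟨hx, hfix⟩
    have h2 := mulVec_lift3_two_ne_zero hN hx
    set c : ℂ := (N *ᵥ lift3 x) 2 with hc
    have hNv : N *ᵥ lift3 x = c • lift3 x := by
      have hl := lift3_actM h2
      rw [hfix] at hl
      conv_rhs => rw [hl]
      rw [smul_smul, mul_inv_cancel₀ h2, one_smul]
    have hzero : (Matrix.scalar (Fin 3) c - N) *ᵥ lift3 x = 0 := by
      rw [Matrix.sub_mulVec, scalar_mulVec, ← hNv, sub_self]
    have hdet : (Matrix.scalar (Fin 3) c - N).det = 0 :=
      Matrix.exists_mulVec_eq_zero_iff.1 ⟨lift3 x, lift3_ne_zero x, hzero⟩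
    have hroot : c ∈ N.charpoly.roots := by
      rw [Polynomial.mem_roots hp, Polynomial.IsRoot.def, Matrix.eval_charpoly]
      exact hdet
    simp only [Set.mem_iUnion, Set.mem_setOf_eq, Finset.mem_coe, Multiset.mem_toFinset]
    exact ⟨_, hroot, hzero⟩
  refine measure_mono_null hsub ((measure_biUnion_null_iff (Finset.countable_toSet _)).2 fun c _ => ?_)
  refine volume_solutionSet _ fun h => hns c ?_
  exact (sub_eq_zero.1 h).symm

/-- `actM (c • M) = actM M` for `c ≠ 0`. -/
theorem actM_smul {c : ℂ} (hc : c ≠ 0) (M : Matrix (Fin 3) (Fin 3) ℂ) : actM (c • M) = actM M := by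
  funext z k
  simp only [actM, Matrix.smul_mulVec, Pi.smul_apply, smul_eq_mul]
  rw [mul_div_mul_left _ _ hc]

/-- `scalar c = c • 1`. -/
theorem scalar_eq_smul_one (c : ℂ) : Matrix.scalar (Fin 3) c = c • (1 : Matrix (Fin 3) (Fin 3) ℂ) := by
  ext i j
  by_cases h : i = j
  · subst h; simp [Matrix.scalar_apply]
  · simp [Matrix.scalar_apply, Matrix.one_apply_ne h, Matrix.diagonal_apply_ne _ h]

end FixedSet

end Summit.Ventures.HodgeRepro.Tier4

end

#print axioms Summit.Ventures.HodgeRepro.Tier4.volume_fixed_null
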